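import Mathlib
import Summits.Ventures.PercRepro2.SPNormalForm3

/-! # The normal form, kernel-computable
(seat mine-b, cell pub-perc-repro2; MINE-B.md §26.7)

`SP.nf` sorts with `List.mergeSort`, a well-founded recursion the kernel does not unfold; `SP.nfK` is
the same normal form with `List.insertionSort` (structural), and `SP.nfK_eq_nf` identifies the two
(`List.Perm.eq_of_pairwise'`: two sorted permutations of a list agree for an antisymmetric order). -/

namespace Summit.Ventures.PercRepro2.V2Closure

open Summit.Ventures.PercRepro2.UHClosure

/-- `SP.le'` is antisymmetric -/
instance SP.le'_antisymm : Std.Antisymm SP.le' := ⟨fun _ _ h₁ h₂ => SP.le_antisymm h₁ h₂⟩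

/-- `SP.le'` is total -/
instance SP.le'_total : Std.Total SP.le' := ⟨fun a b => by
  have h := SP.le_total a b
  simp only [Bool.or_eq_true] at h
  exact h⟩

/-- `SP.le'` is transitive -/
instance SP.le'_isTrans : IsTrans SP SP.le' := ⟨fun _ _ _ h₁ h₂ => SP.le_trans h₁ h₂⟩

/-- **the normal form with a structurally recursive sort** -/
def SP.nfK : SP → SP
  | .ser s t => SP.serOfList ((s.nfK.serFactors ++ t.nfK.serFactors).insertionSort SP.le')
  | .par s t => SP.parOfList ((s.nfK.parFactors ++ t.nfK.parFactors).insertionSort SP.le')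
  | s => s

/-- insertion sort and merge sort agree on `SP` (the order is antisymmetric) -/
theorem SP.insertionSort_eq_mergeSort (l : List SP) : l.insertionSort SP.le' = l.mergeSort SP.le :=
  List.Perm.eq_of_pairwise' (List.pairwise_insertionSort SP.le' l)
    (List.pairwise_mergeSort SP.le_trans' SP.le_total' l)
    ((List.perm_insertionSort SP.le' l).trans (List.mergeSort_perm l SP.le).symm)

/-- **the two normal forms agree** -/
theorem SP.nfK_eq_nf : ∀ s : SP, s.nfK = s.nf
  | .free => rfl
  | .pin => rfl
  | .absent => rfl
  | .ser s t => by
    show SP.serOfList ((s.nfK.serFactors ++ t.nfK.serFactors).insertionSort SP.le') =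
      SP.serOfList ((s.nf.serFactors ++ t.nf.serFactors).mergeSort SP.le)
    rw [SP.nfK_eq_nf s, SP.nfK_eq_nf t, SP.insertionSort_eq_mergeSort]
  | .par s t => by
    show SP.parOfList ((s.nfK.parFactors ++ t.nfK.parFactors).insertionSort SP.le') =
      SP.parOfList ((s.nf.parFactors ++ t.nf.parFactors).mergeSort SP.le)
    rw [SP.nfK_eq_nf s, SP.nfK_eq_nf t, SP.insertionSort_eq_mergeSort]

/-- **(UH*) of the kernel-computable normal form from (UH*) of the term** -/
theorem SP.universal_nfK (s : SP) (h : Universal s.rLab s.bLab) : Universal s.nfK.rLab s.nfK.bLab := by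
  rw [SP.nfK_eq_nf]; exact SP.universal_nf s h

end Summit.Ventures.PercRepro2.V2Closure
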